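import Literature.NumberTheory.EllipticCurves.TianYuanZhang2017.GenusPeriodsParity
import Mathlib.MeasureTheory.Function.JacobianOneDim
import HarnessLib

/-!
# The real period of the congruent number curves `y² = x³ − n²x`: `Ω(E_n) = (2/√n)∫₁^∞ dt/√(t³ − t)` (Tian–Yuan–Zhang's `Ω_{n,∞}`)

HONEST FRAMING (cell `b2b-bsdres`, sub-lane «bsd-p2», run/shared/lean/b2b/bsd-rank1-residual/p2/;
seat p2-lit-1 GEN 5): PROOFS ONLY — no definition, no named fact, nothing asserted beyond what is
proved. This file discharges leg (i) of the content of the (unproved, L-G1-flagged) bridge fact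
`TianYuanZhang2017.bsd_iff_cardSha_eq_scriptLSq` of `GenusPeriodsParity.lean`: the identification
of the authors' real period `Ω_{n,∞}` [cite: TianYuanZhang2017, §1 (arXiv:1411.4728 chunk p0002 L67):
"`Ω_{n,∞} = (2/√n) ∫₁^∞ dx/√(x³ − x)`"] with the tree's BSD period `realPeriodRat` of the global
minimal model `congruentNumberCurve n = ⟨0, 0, 0, −n², 0⟩` (the other legs — `∏ c_p = 2^{2k(n)+2−a(n)}`,
`#E_n(ℚ)_tors = 4`, `R_n = regulator` — are not touched here).

The tree defines (`RealPeriod.lean`) `Ω(W) = 2 ∫_{ψ > 0} dx/√ψ(x)` with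
`ψ = 4x³ + b₂x² + 2b₄x + b₆`. For `E_n`: `ψ(x) = 4(x³ − n²x)`, `{ψ > 0} = (−n, 0) ∪ (n, ∞)`.
Proof (classical; e.g. [folklore], Cremona, *Algorithms for Modular Elliptic Curves*, §3.7, the
rectangular case `Δ > 0` where the two real components carry equal mass of `|ω|`):
* SCALING: over `ℝ`, `E_n = C • E_1` for the admissible change of variables `C = (u, r, s, t) =
  ((√n)⁻¹, 0, 0, 0)` (`a₄ ↦ u⁻⁴ a₄ = −n²`), so `Ω(E_n) = |u| Ω(E_1) = Ω(E_1)/√n` by the tree's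
  PROVED `realPeriod_smul_holds` (`realPeriod_congruentNumberCurve_eq`);
* `n = 1`: the substitution `u = −1/x` maps `(1, ∞)` onto `(−1, 0)` and carries `dx/√ψ(x)` to
  `du/√ψ(u)` EXACTLY (`ψ(−1/x) = ψ(x)/x⁴`), by Mathlib's one-dimensional change-of-variables
  formula `MeasureTheory.integral_image_eq_integral_abs_deriv_smul` (no integrability needed); hence
  the bounded component `(−1, 0)` and the unbounded one `(1, ∞)` contribute equally
  (`setIntegral_inv_sqrt_Ioo_eq_Ioi`) and `Ω(E_1) = 2 · 2 ∫₁^∞ dx/√(4(x³ − x)) = 2 ∫₁^∞ dx/√(x³ − x)`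
  (`realPeriod_congruentNumberCurve_one`; the splitting of `∫_{(−1,0) ∪ (1,∞)}` uses the tree's
  PROVED integrability `integrableOn_inv_sqrt_twoTorsionPolynomial'`).
Main statement: `realPeriodRat_congruentNumberCurve : Ω(E_n) = realPeriodTYZ n` for `0 < n`,
and the closed form `Ω(E_n)·√n = Ω(E_1)` (`realPeriodRat_congruentNumberCurve_mul_sqrt`).

Numerical cross-check (EVIDENCE only, already on record in `GenusPeriodsParity.lean`'s docstring,
kit job `j142692`): `Ω_{n,∞}` = PARI's `E.omega[1]` (two real components) for all square-free
`n ≤ 79`; `Ω(E_1) = 2 ∫₁^∞ dx/√(x³ − x) = Γ(1/4)²/(2√(2π)) = 5.2441151…`.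

## References
* [TianYuanZhang2017] Y. Tian, X. Yuan, S.-W. Zhang, Asian J. Math. 21 (2017), §1 (definition of `Ω_{n,∞}`).
* J. E. Cremona, *Algorithms for Modular Elliptic Curves*, 2nd ed., §3.7 (period lattice, `Δ > 0`).
* Tree: `Literature/NumberTheory/EllipticCurves/RealPeriod.lean` (`realPeriod`, `realPeriod_smul_holds`,
  `integrableOn_inv_sqrt_twoTorsionPolynomial'`), `BSDInvariants.lean` (`realPeriodRat`).
-/

noncomputable section

open MeasureTheory Set Polynomial

namespace Literature.NumberTheory.EllipticCurves.TianYuanZhang2017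

open WeierstrassCurve Literature.NumberTheory.EllipticCurves

/-! ### §1. The real model `E_n ⊗ ℝ` and its two-torsion data -/

/-- `E_n ⊗_ℚ ℝ = ⟨0, 0, 0, −n², 0⟩` over `ℝ`. [folklore] -/
private theorem baseChange_congruentNumberCurve (n : ℕ) :
    (congruentNumberCurve n).baseChange ℝ = ⟨0, 0, 0, -((n : ℝ) ^ 2), 0⟩ := by
  ext <;> simp [congruentNumberCurve]

/-- The two-torsion polynomial of `E_n ⊗ ℝ`: `ψ(x) = 4x³ + b₂x² + 2b₄x + b₆ = 4(x³ − n²x)`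
(`b₂ = b₆ = 0`, `b₄ = 2a₄ = −2n²`); Cremona's `ψ/4 = x³ + (b₂/4)x² + (b₄/2)x + b₆/4` for this model.
[cite: CremonaAlgorithms1997, §3.7 (3.7.1)] -/
theorem eval_twoTorsionPolynomial_congruentNumberCurve (n : ℕ) (x : ℝ) :
    ((congruentNumberCurve n).baseChange ℝ).twoTorsionPolynomial.toPoly.eval x =
      4 * (x ^ 3 - (n : ℝ) ^ 2 * x) := by
  rw [WeierstrassCurve.eval_twoTorsionPolynomial, baseChange_congruentNumberCurve]
  simp only [WeierstrassCurve.b₂, WeierstrassCurve.b₄, WeierstrassCurve.b₆]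
  ring

/-- Sign of `x³ − x = x(x − 1)(x + 1)`: positive exactly on `(−1, 0) ∪ (1, ∞)`. [folklore] -/
private theorem cube_sub_self_pos_iff (x : ℝ) : 0 < x ^ 3 - x ↔ (-1 < x ∧ x < 0) ∨ 1 < x := by
  have hfac : x ^ 3 - x = x * (x - 1) * (x + 1) := by ring
  constructor
  · intro h
    by_contra hc
    push Not at hc
    rcases le_or_gt x (-1) with h1 | h1
    · -- `x ≤ −1`: `x(x−1) > 0` and `x + 1 ≤ 0`
      have hA : 0 < x * (x - 1) := by nlinarith
      have : x * (x - 1) * (x + 1) ≤ 0 := mul_nonpos_of_nonneg_of_nonpos hA.le (by linarith)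
      linarith
    · -- `−1 < x`, so `0 ≤ x ≤ 1`: `x(x−1) ≤ 0` and `x + 1 > 0`
      have h0 : 0 ≤ x := hc.1 h1
      have hA : x * (x - 1) ≤ 0 := mul_nonpos_of_nonneg_of_nonpos h0 (by linarith [hc.2])
      have : x * (x - 1) * (x + 1) ≤ 0 := mul_nonpos_of_nonpos_of_nonneg hA (by linarith)
      linarith
  · rintro (⟨h1, h2⟩ | h)
    · have hA : 0 < x * (x - 1) := by nlinarith
      have : 0 < x * (x - 1) * (x + 1) := mul_pos hA (by linarith)
      linarith
    · have hA : 0 < x * (x - 1) := by nlinarith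
      have : 0 < x * (x - 1) * (x + 1) := mul_pos hA (by linarith)
      linarith

/-- `{ψ > 0}` for `E_1 ⊗ ℝ` is `(−1, 0) ∪ (1, ∞)`: the rectangular case `Δ > 0`, three real roots
`e₁ = −1 < e₂ = 0 < e₃ = 1` of `ψ/4 = x³ − x`, `ψ > 0` on `(e₁, e₂) ∪ (e₃, ∞)`.
[cite: CremonaAlgorithms1997, §3.7 (3.7.1), case Δ > 0] -/
theorem twoTorsionSet_congruentNumberCurve_one :
    ((congruentNumberCurve 1).baseChange ℝ).twoTorsionSet = Ioo (-1) 0 ∪ Ioi 1 := by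
  ext x
  rw [WeierstrassCurve.mem_twoTorsionSet_iff, eval_twoTorsionPolynomial_congruentNumberCurve]
  simp only [Nat.cast_one, one_pow, one_mul, mem_union, mem_Ioo, mem_Ioi]
  rw [← cube_sub_self_pos_iff]
  constructor
  · intro h; linarith
  · intro h; linarith

/-! ### §2. The substitution `u = −1/x`: both real components carry the same mass -/

/-- The image of `(1, ∞)` under `x ↦ −1/x` is `(−1, 0)`. [folklore] -/
private theorem image_neg_inv_Ioi_one : (fun x : ℝ => -x⁻¹) '' Ioi 1 = Ioo (-1) 0 := by
  ext u
  constructor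
  · rintro ⟨x, hx, rfl⟩
    have hx : (1 : ℝ) < x := hx
    have h1 : x⁻¹ < 1 := inv_lt_one_of_one_lt₀ hx
    have h2 : 0 < x⁻¹ := inv_pos.mpr (by linarith)
    exact ⟨by linarith, by linarith⟩
  · rintro ⟨h1, h2⟩
    refine ⟨-u⁻¹, ?_, by simp⟩
    show (1 : ℝ) < -u⁻¹
    rw [← inv_neg]
    exact (one_lt_inv₀ (by linarith)).mpr (by linarith)

/-- For `x > 0`: `ψ₁(−1/x) = ψ₁(x)/x⁴` where `ψ₁(y) = 4(y³ − y)`, hence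
`x⁻² · (√ψ₁(−1/x))⁻¹ = (√ψ₁(x))⁻¹`. [folklore] -/
private theorem inv_sq_mul_inv_sqrt_neg_inv {x : ℝ} (hx : 1 < x) :
    (x ^ 2)⁻¹ * (Real.sqrt (4 * ((-x⁻¹) ^ 3 - -x⁻¹)))⁻¹ = (Real.sqrt (4 * (x ^ 3 - x)))⁻¹ := by
  have hx0 : 0 < x := by linarith
  have hx0' : x ≠ 0 := hx0.ne'
  have key : 4 * ((-x⁻¹) ^ 3 - -x⁻¹) = (4 * (x ^ 3 - x)) / x ^ 4 := by
    field_simp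
    ring
  have hx4 : Real.sqrt (x ^ 4) = x ^ 2 := by
    rw [show x ^ 4 = (x ^ 2) ^ 2 by ring, Real.sqrt_sq (by positivity)]
  have hpos : 0 < 4 * (x ^ 3 - x) := by
    have := (cube_sub_self_pos_iff x).mpr (Or.inr hx)
    linarith
  have hA : 0 < Real.sqrt (4 * (x ^ 3 - x)) := Real.sqrt_pos.mpr hpos
  rw [key, Real.sqrt_div' _ (by positivity : (0 : ℝ) ≤ x ^ 4), hx4]
  field_simp

/-- **Equal mass of the two real components**: `∫_{(−1,0)} dx/√(4(x³ − x)) = ∫_{(1,∞)} dx/√(4(x³ − x))`,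
by the change of variables `u = −1/x` (Mathlib's `integral_image_eq_integral_abs_deriv_smul`; holds
for the Bochner integral with no integrability hypothesis). [folklore] -/
private theorem setIntegral_inv_sqrt_Ioo_eq_Ioi :
    ∫ x in Ioo (-1 : ℝ) 0, (Real.sqrt (4 * (x ^ 3 - x)))⁻¹ =
      ∫ x in Ioi (1 : ℝ), (Real.sqrt (4 * (x ^ 3 - x)))⁻¹ := by
  have hderiv : ∀ x ∈ Ioi (1 : ℝ),
      HasDerivWithinAt (fun y : ℝ => -y⁻¹) ((x ^ 2)⁻¹) (Ioi 1) x := by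
    intro x hx
    have hx0 : x ≠ 0 := by
      have : (1 : ℝ) < x := hx
      exact ne_of_gt (by linarith)
    have h := (hasDerivAt_inv hx0).neg
    simp only [neg_neg] at h
    exact h.hasDerivWithinAt
  have hinj : InjOn (fun y : ℝ => -y⁻¹) (Ioi 1) := by
    intro x _ y _ h
    simpa using h
  rw [← image_neg_inv_Ioi_one,
    integral_image_eq_integral_abs_deriv_smul measurableSet_Ioi hderiv hinj]
  refine setIntegral_congr_fun measurableSet_Ioi (fun x hx => ?_)
  have hx : (1 : ℝ) < x := hx
  simp only [smul_eq_mul]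
  rw [abs_of_pos (by positivity : (0 : ℝ) < (x ^ 2)⁻¹)]
  exact inv_sq_mul_inv_sqrt_neg_inv hx

/-! ### §3. `Ω(E_1) = 2 ∫₁^∞ dx/√(x³ − x)` -/

/-- `√(4y) = 2√y`, in the form `(√(4y))⁻¹ = ½ (√y)⁻¹`. [folklore] -/
private theorem inv_sqrt_four_mul (y : ℝ) :
    (Real.sqrt (4 * y))⁻¹ = (1 / 2) * (Real.sqrt y)⁻¹ := by
  have h4 : Real.sqrt 4 = 2 := by
    rw [show (4 : ℝ) = 2 ^ 2 by norm_num, Real.sqrt_sq (by norm_num)]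
  rw [Real.sqrt_mul (by norm_num : (0 : ℝ) ≤ 4), h4, mul_inv]
  ring

/-- **The real period of `y² = x³ − x`** in the tree's normalisation
(`Ω = 2 ∫_{ψ>0} dx/√ψ`, both components): `Ω(E_1) = 2 ∫₁^∞ dx/√(x³ − x)` (`= 5.2441151…`), i.e.
Tian–Yuan–Zhang's `Ω_{1,∞}`; the two real components contribute equally (Cremona: `Ω = 2λ₁` in the
rectangular case). [cite: TianYuanZhang2017, §1, definition of Ω_{n,∞} (arXiv:1411.4728 chunk p0002 L67), n = 1]
[cite: CremonaAlgorithms1997, §3.7 (Δ > 0: Ω = 2λ₁)] -/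
theorem realPeriod_congruentNumberCurve_one :
    ((congruentNumberCurve 1).baseChange ℝ).realPeriod =
      2 * ∫ x in Ioi (1 : ℝ), (Real.sqrt (x ^ 3 - x))⁻¹ := by
  haveI : (congruentNumberCurve 1).IsElliptic := isElliptic_congruentNumberCurve one_ne_zero
  have hint := ((congruentNumberCurve 1).baseChange ℝ).integrableOn_inv_sqrt_twoTorsionPolynomial'
  unfold WeierstrassCurve.realPeriod
  simp_rw [eval_twoTorsionPolynomial_congruentNumberCurve] at hint ⊢
  rw [twoTorsionSet_congruentNumberCurve_one] at hint ⊢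
  simp only [Nat.cast_one, one_pow, one_mul] at hint ⊢
  have hdisj : Disjoint (Ioo (-1 : ℝ) 0) (Ioi 1) := by
    rw [Set.disjoint_left]
    intro x hx hx'
    have h1 : x < 0 := hx.2
    have h2 : (1 : ℝ) < x := hx'
    linarith
  rw [setIntegral_union hdisj measurableSet_Ioi (hint.mono_set subset_union_left)
      (hint.mono_set subset_union_right),
    setIntegral_inv_sqrt_Ioo_eq_Ioi]
  simp_rw [inv_sqrt_four_mul, integral_const_mul]
  ring

/-! ### §4. Scaling `E_n = C • E_1` over `ℝ` and the main statements -/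

/-- **Scaling.** `Ω(E_n) = Ω(E_1)/√n` for `0 < n`: over `ℝ`, `E_n = C • E_1` with
`C = ((√n)⁻¹, 0, 0, 0)` and `Ω(C • W) = |u| Ω(W)` (tree `realPeriod_smul_holds`; Silverman's `ω' = uω`,
Table 3.1); equivalently Pal's period relation `Ω(E^d) = (ũ/√d)Ω(E)` for the twist of `E_1` by
`d = n > 0` with `ũ = 1`. [cite: SilvermanAEC2009, §III.1 Table 3.1] [cite: Pal2012, Lemma 3.1 and Thm. 3.2 (case d > 0)] -/
theorem realPeriod_congruentNumberCurve_eq {n : ℕ} (hn : 0 < n) :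
    ((congruentNumberCurve n).baseChange ℝ).realPeriod =
      (Real.sqrt n)⁻¹ * ((congruentNumberCurve 1).baseChange ℝ).realPeriod := by
  have hsq : 0 < Real.sqrt n := Real.sqrt_pos.mpr (by exact_mod_cast hn)
  have h4 : Real.sqrt n ^ 4 = (n : ℝ) ^ 2 := by
    rw [show (4 : ℕ) = 2 * 2 from rfl, pow_mul, Real.sq_sqrt (Nat.cast_nonneg n)]
  let C : VariableChange ℝ := ⟨Units.mk0 (Real.sqrt n)⁻¹ (inv_ne_zero hsq.ne'), 0, 0, 0⟩
  have hcurve : (congruentNumberCurve n).baseChange ℝ =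
      C • (congruentNumberCurve 1).baseChange ℝ := by
    rw [baseChange_congruentNumberCurve, baseChange_congruentNumberCurve]
    ext
    · simp [C, variableChange_a₁]
    · simp [C, variableChange_a₂]
    · simp [C, variableChange_a₃]
    · simp [C, variableChange_a₄, Units.val_inv_eq_inv_val, h4]
    · simp [C, variableChange_a₆]
  rw [hcurve, ((congruentNumberCurve 1).baseChange ℝ).realPeriod_smul_holds C]
  simp [C, abs_of_pos (inv_pos.mpr hsq)]

/-- **Main statement.** For `0 < n` the tree's BSD period of the global minimal model
`congruentNumberCurve n` equals Tian–Yuan–Zhang's `Ω_{n,∞} = (2/√n) ∫₁^∞ dx/√(x³ − x)`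
(`realPeriodTYZ n`) — the period entering the printed form (1.1) of the BSD formula for `E_n`.
[cite: TianYuanZhang2017, §1, (1.1) and the definition of Ω_{n,∞} (arXiv:1411.4728 chunk p0002 L67, L71–L75)] -/
theorem realPeriodRat_congruentNumberCurve {n : ℕ} (hn : 0 < n) :
    (congruentNumberCurve n).realPeriodRat = realPeriodTYZ n := by
  rw [WeierstrassCurve.realPeriodRat, realPeriod_congruentNumberCurve_eq hn,
    realPeriod_congruentNumberCurve_one, realPeriodTYZ]
  simp_rw [one_div]
  ring

/-- Closed form of the scaling law: `Ω(E_n) · √n = Ω(E_1)` (`0 < n`) — Pal's `Ω(E^d)√d = ũ Ω(E)`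
with `ũ = 1` for the twist `E_n` of `E_1` by `d = n`. [cite: Pal2012, Lemma 3.1 and Thm. 3.2 (case d > 0)] -/
theorem realPeriodRat_congruentNumberCurve_mul_sqrt {n : ℕ} (hn : 0 < n) :
    (congruentNumberCurve n).realPeriodRat * Real.sqrt n = (congruentNumberCurve 1).realPeriodRat := by
  have hsq : 0 < Real.sqrt n := Real.sqrt_pos.mpr (by exact_mod_cast hn)
  rw [WeierstrassCurve.realPeriodRat, WeierstrassCurve.realPeriodRat,
    realPeriod_congruentNumberCurve_eq hn]
  field_simp

/-- `Ω(E_1)` in both currencies: `realPeriodRat (congruentNumberCurve 1) = Ω_{1,∞} = 2 ∫₁^∞ dx/√(x³ − x)`.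
[cite: TianYuanZhang2017, §1, definition of Ω_{n,∞} (arXiv:1411.4728 chunk p0002 L67), n = 1] -/
theorem realPeriodRat_congruentNumberCurve_one :
    (congruentNumberCurve 1).realPeriodRat = 2 * ∫ x in Ioi (1 : ℝ), (Real.sqrt (x ^ 3 - x))⁻¹ :=
  realPeriod_congruentNumberCurve_one

end Literature.NumberTheory.EllipticCurves.TianYuanZhang2017

end
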